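import Literature.NumberTheory.Sieve.GreenTaoFromSzemeredi
import Literature.Combinatorics.Additive.RelativeSzemerediDenseModel
import Literature.Combinatorics.Additive.RelativeSzemerediCounting
import Literature.Combinatorics.Additive.SzemerediTheorem
import HarnessLib

/-!
# Green–Tao 2008, Proposition 2.3 from Szemerédi's theorem, and Theorem 1.1 from Szemerédi's theorem

Trunk T-SIEVE. B. Green, T. Tao, *The primes contain arbitrarily long arithmetic progressions*,
Ann. of Math. 167 (2008), 481–547.

* `GreenTao2008.szemerediExpectation_of_szemerediTheorem` — PROVED: Green–Tao's Prop. 2.3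
  (Szemerédi's theorem in expectation form, the tree's named fact
  `Literature.NumberTheory.Sieve.GreenTao2008.SzemerediExpectation`) follows from the finitary
  Szemerédi theorem (`Literature.Combinatorics.Additive.SzemerediTheorem`, Szemerédi 1975) by
  Varnavides' averaging (`SzemerediTheorem.le_card_apPairs`) and the passage set ↦ function,
  `[N] ↦ ℤ/Nℤ`: for `f : ℤ_N → [0,1]` with `E f ≥ δ` the set `{n < N : f(n) ≥ δ/2}` has density
  `≥ δ/2`, its `≥ c₀ N²` integer progressions `(a, d)`, `a, d < N`, are distinct progressions of
  `ℤ_N` on which `∏ f(x + i r) ≥ (δ/2)^k`. This is the deduction the source indicates on p. 486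
  ("can be deduced from Proposition 2.1 with some combinatorial trickery … Varnavides [43]").
* `exists_prime_arithmetic_progression_of_szemerediTheorem` — PROVED: with the dense model
  theorem (`CFZ.denseModel_holds`) and the relative counting lemma (`CFZ.relativeCounting_holds`)
  already proved in the tree, Green–Tao's Theorem 1.1
  (`Literature.NumberTheory.Sieve.exists_prime_arithmetic_progression`) holds conditionally on
  the single named fact `SzemerediTheorem` — exactly what the source assumes ("in this paper, we
  must assume Szemerédi's theorem", p. 484).

## References
* B. Green, T. Tao, Ann. of Math. 167 (2008), Prop. 2.1, Prop. 2.3, p. 486, Thm. 1.1.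
  [cite: GreenTaoAnnals2008]
* P. Varnavides, J. London Math. Soc. 34 (1959), 358–360. [cite: Varnavides1959]
-/


noncomputable section

namespace Literature.NumberTheory.Sieve.GreenTao2008

open Filter Finset Literature.Combinatorics.Additive
open scoped BigOperators

/-- Reindexing a sum over `ℤ/Nℤ` by the representatives `0, …, N-1`. [folklore] -/
theorem sum_univ_zmod_eq_sum_range {N : ℕ} [NeZero N] (g : ZMod N → ℝ) :
    ∑ x : ZMod N, g x = ∑ n ∈ range N, g (n : ZMod N) := by
  refine (Finset.sum_nbij' (fun n : ℕ => (n : ZMod N)) (fun x : ZMod N => x.val) ?_ ?_ ?_ ?_ ?_).symm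
  · intro n _; exact mem_univ _
  · intro x _; exact mem_range.2 (ZMod.val_lt x)
  · intro n hn; exact ZMod.val_natCast_of_lt (mem_range.1 hn)
  · intro x _; exact ZMod.natCast_zmod_val x
  · intro n _; rfl

/-- The double expectation over `ℤ_N × ℤ_N` as a normalised double sum. [folklore] -/
theorem expect_expect_eq_sum_div {N : ℕ} [NeZero N] (F : ZMod N → ZMod N → ℝ) :
    𝔼 x : ZMod N, 𝔼 r : ZMod N, F x r =
      (∑ p ∈ (univ : Finset (ZMod N)) ×ˢ (univ : Finset (ZMod N)), F p.1 p.2) / (N : ℝ) ^ 2 := by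
  simp only [expect_eq_sum_div_card, card_univ, ZMod.card, ← Finset.sum_div, sum_product, div_div, sq]


/-- **Green–Tao 2008, Proposition 2.3 (Szemerédi's theorem, expectation form) from Szemerédi's
theorem (finitary set form) via Varnavides.** Given `f : ℤ_N → [0,1]` with `E(f) ≥ δ`, the set
`A = {n < N : f(n) ≥ δ/2}` has `#A ≥ δN/2`; by Varnavides it contains `≥ c₀ N²` progressions
`(a, d)` with `a, d < N`, `d ≥ 1`, which are distinct progressions in `ℤ_N` on each of which
`f(x) f(x+r) ⋯ f(x+(k-1)r) ≥ (δ/2)^k`; hence `E(∏ f(x + i r) | x, r) ≥ c₀ (δ/2)^k` with no error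
term (so `c(k, δ) = c₀(k, δ/2) (δ/2)^k` and the `o(1)` is `0`). This is the deduction indicated by
Green–Tao (p. 486: "such a statement can be deduced from Proposition 2.1 with some combinatorial
trickery … Varnavides [43]"). [cite: GreenTaoAnnals2008, Proposition 2.3 (deduction from Prop. 2.1, p. 486)] -/
theorem szemerediExpectation_of_szemerediTheorem (h : SzemerediTheorem) : SzemerediExpectation := by
  classical
  intro k _hk δ hδ _hδ1
  obtain ⟨c₀, hc₀, N₀, hN₀⟩ := SzemerediTheorem.le_card_apPairs h k (half_pos hδ)
  refine ⟨c₀ * (δ / 2) ^ k, by positivity, fun η hη => ?_⟩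
  filter_upwards [eventually_ge_atTop N₀] with N hN
  intro _ f hf0 hf1 hfδ
  set A : Finset ℕ := (range N).filter (fun n : ℕ => δ / 2 ≤ f (n : ZMod N)) with hA
  have hAsub : A ⊆ range N := filter_subset _ _
  have hNpos : (0 : ℝ) < N := by exact_mod_cast Nat.pos_of_ne_zero (NeZero.ne N)
  -- density of `A`
  have hcardA : δ / 2 * N ≤ #A := by
    have hE : 𝔼 x, f x = (∑ n ∈ range N, f (n : ZMod N)) / N := by
      rw [expect_eq_sum_div_card, card_univ, ZMod.card, sum_univ_zmod_eq_sum_range f]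
    have h1 : ∑ n ∈ range N, f (n : ZMod N) ≤ #A + N * (δ / 2) := by
      rw [← sum_filter_add_sum_filter_not (range N) (fun n : ℕ => δ / 2 ≤ f (n : ZMod N))]
      refine add_le_add ?_ ?_
      · calc ∑ n ∈ (range N).filter (fun n : ℕ => δ / 2 ≤ f (n : ZMod N)), f (n : ZMod N)
            ≤ ∑ n ∈ (range N).filter (fun n : ℕ => δ / 2 ≤ f (n : ZMod N)), (1 : ℝ) :=
              sum_le_sum fun n _ => hf1 _
          _ = #A := by rw [sum_const, nsmul_eq_mul, mul_one]
      · calc ∑ n ∈ (range N).filter (fun n : ℕ => ¬ δ / 2 ≤ f (n : ZMod N)), f (n : ZMod N)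
            ≤ ∑ n ∈ (range N).filter (fun n : ℕ => ¬ δ / 2 ≤ f (n : ZMod N)), δ / 2 :=
              sum_le_sum fun n hn => (not_le.1 (mem_filter.1 hn).2).le
          _ = #((range N).filter (fun n : ℕ => ¬ δ / 2 ≤ f (n : ZMod N))) * (δ / 2) := by
              rw [sum_const, nsmul_eq_mul]
          _ ≤ N * (δ / 2) := by
              gcongr
              exact_mod_cast (card_le_card (filter_subset _ _)).trans (card_range N).le
    have h2 : δ ≤ (∑ n ∈ range N, f (n : ZMod N)) / N := hE ▸ hfδ
    rw [le_div_iff₀ hNpos] at h2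
    linarith
  have hcount : c₀ * (N : ℝ) ^ 2 ≤ #(apPairs k N A) := hN₀ N hN A hAsub hcardA
  -- each counted progression contributes at least `(δ/2)^k`
  have hterm : ∀ p ∈ apPairs k N A,
      (δ / 2) ^ k ≤ ∏ i : Fin k, f ((p.1 : ZMod N) + ((i : ℕ) : ZMod N) * (p.2 : ZMod N)) := by
    intro p hp
    rw [mem_apPairs] at hp
    calc (δ / 2) ^ k = ∏ _i : Fin k, δ / 2 := by rw [prod_const, card_univ, Fintype.card_fin]
      _ ≤ ∏ i : Fin k, f ((p.1 : ZMod N) + ((i : ℕ) : ZMod N) * (p.2 : ZMod N)) := by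
          refine prod_le_prod (fun i _ => by positivity) fun i _ => ?_
          have hmem : p.1 + (i : ℕ) * p.2 ∈ A := hp.2.2.2 i i.isLt
          have := (mem_filter.1 hmem).2
          push_cast at this
          exact this
  -- the counted progressions are distinct in `ℤ_N × ℤ_N`
  have hinj : Set.InjOn (fun p : ℕ × ℕ => ((p.1 : ZMod N), (p.2 : ZMod N))) (apPairs k N A) := by
    intro p hp q hq hpq
    rw [mem_coe, mem_apPairs] at hp hq
    simp only [Prod.mk.injEq] at hpq
    have h1 := congrArg ZMod.val hpq.1
    have h2 := congrArg ZMod.val hpq.2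
    rw [ZMod.val_natCast_of_lt hp.1, ZMod.val_natCast_of_lt hq.1] at h1
    rw [ZMod.val_natCast_of_lt hp.2.1, ZMod.val_natCast_of_lt hq.2.1] at h2
    exact Prod.ext h1 h2
  have hsum : (#(apPairs k N A) : ℝ) * (δ / 2) ^ k ≤
      ∑ p ∈ (univ : Finset (ZMod N)) ×ˢ (univ : Finset (ZMod N)),
        ∏ i : Fin k, f (p.1 + ((i : ℕ) : ZMod N) * p.2) := by
    calc (#(apPairs k N A) : ℝ) * (δ / 2) ^ k = ∑ _p ∈ apPairs k N A, (δ / 2) ^ k := by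
          rw [sum_const, nsmul_eq_mul]
      _ ≤ ∑ p ∈ apPairs k N A,
            ∏ i : Fin k, f ((p.1 : ZMod N) + ((i : ℕ) : ZMod N) * (p.2 : ZMod N)) := sum_le_sum hterm
      _ = ∑ p ∈ (apPairs k N A).image (fun p : ℕ × ℕ => ((p.1 : ZMod N), (p.2 : ZMod N))),
            ∏ i : Fin k, f (p.1 + ((i : ℕ) : ZMod N) * p.2) := by rw [sum_image hinj]
      _ ≤ ∑ p ∈ (univ : Finset (ZMod N)) ×ˢ (univ : Finset (ZMod N)),
            ∏ i : Fin k, f (p.1 + ((i : ℕ) : ZMod N) * p.2) := by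
          refine sum_le_sum_of_subset_of_nonneg (fun p _ => mem_product.2 ⟨mem_univ _, mem_univ _⟩) ?_
          intro p _ _
          exact prod_nonneg fun i _ => hf0 _
  rw [expect_expect_eq_sum_div, le_div_iff₀ (by positivity)]
  have hη' : 0 ≤ η * (N : ℝ) ^ 2 := by positivity
  nlinarith [hsum, hcount, pow_nonneg (half_pos hδ).le k]

end Literature.NumberTheory.Sieve.GreenTao2008

namespace Literature.NumberTheory.Sieve

/-- **Green–Tao, Theorem 1.1, from Szemerédi's theorem alone.** With the dense model theorem
(`CFZ.denseModel_holds`) and the relative counting lemma (`CFZ.relativeCounting_holds`) proved in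
the tree, and Prop. 2.3 derived from the finitary Szemerédi theorem
(`GreenTao2008.szemerediExpectation_of_szemerediTheorem`), the primes contain arbitrarily long
arithmetic progressions conditionally on the single named fact
`Literature.Combinatorics.Additive.SzemerediTheorem` (Szemerédi 1975) — exactly the input the
source assumes ("in this paper, we must assume Szemerédi's theorem", p. 484).
[cite: GreenTaoAnnals2008, Theorem 1.1] -/
theorem exists_prime_arithmetic_progression_of_szemerediTheorem
    (h : Literature.Combinatorics.Additive.SzemerediTheorem) : exists_prime_arithmetic_progression :=
  exists_prime_arithmetic_progression_of_szemeredi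
    (GreenTao2008.szemerediExpectation_of_szemerediTheorem h)
    Literature.Combinatorics.Additive.CFZ.denseModel_holds
    Literature.Combinatorics.Additive.CFZ.relativeCounting_holds

end Literature.NumberTheory.Sieve
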